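import Summits.BirchSwinnertonDyer.BirchSwinnertonDyer.Theorems.ManinLocalTwoThreeManinPrimeToAdditiveFiveLeBistarredGord
import Summits.BirchSwinnertonDyer.BirchSwinnertonDyer.Theorems.ManinLocalTwoThreeManinPrimeToAdditiveFiveLeReducibleResidueThirteen
import Summits.BirchSwinnertonDyer.BirchSwinnertonDyer.Theorems.EdixhovenFibreFiveSevenMemberManinUnitFiveSevenGlue
import Summits.BirchSwinnertonDyer.Rank1Residual.Additive.SubGordHigherOrdinary
import Summits.BirchSwinnertonDyer.Rank1Residual.Additive.CyclotomicGoodOrdinary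
import Summits.BirchSwinnertonDyer.Rank1Residual.Additive.TypeGRamification
import HarnessLib

/-!
# Route `ManinLocalTwoThree`, residual crux C5 `ManinPrimeToAdditiveFiveLe`
# (stmt-BirchSwinnertonDyer-22969), line `upper_anchor`: **the potentially supersingular bi-starred corner
# in KODAIRA SYMBOLS — (5; IV*), (5; II*), (7; III*) — and its equivalence with the (G)-non-ordinary form**

Width seat bsd-line-ml23-c5-p1-w2 (gen 3), piece λ4, sequel of `…BistarredGord` (p621355: the registered
stub `stub_red57bistarred` of skeleton v6/v7 ⟸ Dokchitser–Dokchitser 2015 ∧ the corner restricted to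
`¬ TypeGOrd W p`). Here the abstract ordinarity binder is traded for the Kodaira symbol, using the
additive cell's PROVED dictionary (Delbourgo (G) ⟺ `ord_p j ≥ 0 ∧ 12 ∣ (p−1)·ord_p Δ`,
`typeG_iff_padicValRat`; (G) + `j̃ = 0` at `p ≡ 1 (3)` / `j̃ = 1728` at `p ≡ 1 (4)` ⟹ (G)-ordinary,
`typeGOrd_of_typeG_of_padicValRat_j[_sub]`; `j̃ = 0` at `p ≢ 1 (3)` / `j̃ = 1728` at `p ≢ 1 (4)` ⟹ not
(G)-ordinary, `not_typeGOrd_of_padicValRat_j_pos_of_not_three_dvd` / `…_j_sub_pos_of_not_four_dvd`;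
`3 ∤ ord_p Δ_min ⟹ j̃ = 0`, `2 ∤ ord_p Δ_min ⟹ j̃ = 1728`) — the in-tree form of [DokchitserDokchitser2015,
Thm. 3.2] («`l ≡ 5 (12)`: potentially ordinary iff III/III*; `l ≡ 7 (12)`: iff II/II*/IV/IV*»):

* §1 `typeGOrd_iff_eq_nine_of_starred_five`, `typeGOrd_iff_ne_nine_of_starred_seven` — for a globally
  minimal `W` additive at `p` with no `Iₙ*` fibre and `4 < ord_p Δ_min(W)` (so Kodaira IV*/III*/II*,
  `ord_p Δ_min ∈ {8, 9, 10}`): at `p = 5`, (G)-ordinary ⟺ `ord₅ Δ_min = 9` (III*); at `p = 7`, (G)-ordinary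
  ⟺ `ord₇ Δ_min ≠ 9` (IV*, II*). Unconditional.
* §2 `red57bistarredNonGord_of_kodairaCorner` and `red57bistarredKodairaCorner_of_nonGord` — the residual
  corner of p621355 (binder `¬ TypeGOrd W p`) is EQUIVALENT to the same statement with that binder replaced
  by `(p = 5 → ord_p Δ_min(W) ≠ 9) → (p = 7 → ord_p Δ_min(W) = 9)`: the corner lives exactly on the
  Kodaira cells (5; IV*), (5; II*), (7; III*) — the STARRED potentially supersingular cells, where the
  rational `p`-isogeny flips the type ([DokchitserDokchitser2015, Cor. 3.3]; Gealy–Klagsbrun 2017).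
* §3 `red57bistarred_of_dokchitser_of_kodairaCorner` — `stub_red57bistarred` VERBATIM ⟸ D–D Thm. 5.1 (1) ∧
  the Kodaira-form corner (p621355 §1 ∘ §2).

Census (cell tables TWISTCENSUS2 / E20, `N ≤ 5·10⁵`): no optimal `W[5]`-reducible curve of type IV* or II*,
no optimal `W[7]`-reducible curve of type III* — the Kodaira-form corner is EMPTY in range before its
partner clause is even read. HONEST STATUS: conditional-result helpers (`--supports … --as helper`);
§1 is unconditional; nothing here proves BSD, Manin's conjecture or C5.

References: [DokchitserDokchitser2015LocalInvariants] Thm. 3.2, Cor. 3.3, Thm. 5.1 (1) (arXiv:1208.5519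
Thm. 7, Cor. 8, Thm. 19); [Delbourgo1998] §1.5; [SilvermanAEC2009] V.4.1, Ex. V.4.4–4.5; [SilvermanATAEC1994]
IV Table 4.1; [GealyKlagsbrun2017] Thm. 1.
-/

set_option autoImplicit false
-- the Theorems namespace of this sub repeats the summit name by design (D-0017 nested layout)
set_option linter.dupNamespace false

noncomputable section

open scoped Classical NumberField

namespace Summit.BirchSwinnertonDyer.BirchSwinnertonDyer.Theorems

open WeierstrassCurve IsDedekindDomain IsDedekindDomain.HeightOneSpectrum Rat.HeightOneSpectrum NumberField
  Literature.NumberTheory.EllipticCurves Literature.NumberTheory.EllipticCurves.ModularForms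
  Literature.NumberTheory.EllipticCurves.Rank1Residual
  Summit.BirchSwinnertonDyer.Rank1Residual.ManinAdditive
  Summit.BirchSwinnertonDyer.Rank1Residual.Additive
  Summit.BirchSwinnertonDyer.BirchSwinnertonDyer.Theses.EdixhovenFibreFiveSeven

/-! ## §1 (G)-ordinarity of a starred additive fibre at `5` and at `7`, read off `ord_p Δ_min` -/

section Dictionary

variable (W : WeierstrassCurve ℚ) [W.IsElliptic] [W.IsGloballyMinimal] (p : ℕ) [hp : Fact p.Prime]

/-- **A starred additive fibre without `Iₙ*` is potentially good with `ord_p Δ_min ∈ {8, 9, 10}`** (`p` odd,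
`4 < ord_p Δ_min`): `ord_p j ≥ 0` (no `Iₙ*` fibre, `padicValRat_j_nonneg_of_forall_ne_Istar`) and Tate's
table at an additive `p ≥ 5` (`kodairaSymbolAt_placeOf_cases_of_addv`). [cite: SilvermanATAEC1994, IV Table 4.1] -/
theorem padicValRat_j_nonneg_and_mem_of_starred (hp5 : 5 ≤ p) (hadd : Addv W p)
    (hI : ∀ n : ℕ, W.kodairaSymbolAt (placeOf p) ≠ .Istar n)
    (hv : 4 < padicValInt p W.minimalDiscriminantInt) :
    0 ≤ padicValRat p W.j ∧ (padicValInt p W.minimalDiscriminantInt = 8 ∨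
      padicValInt p W.minimalDiscriminantInt = 9 ∨ padicValInt p W.minimalDiscriminantInt = 10) := by
  have hp2 : p ≠ 2 := by omega
  refine ⟨?_, ?_⟩
  · refine MemberManinUnitFiveSevenGlue.padicValRat_j_nonneg_of_forall_ne_Istar W hp2 hadd ?_
    intro v n hv' hK
    have hvv : v = placeOf p := (primesEquiv (R := ℤ)).injective
      (Subtype.ext (hv'.trans (natGenerator_placeOf_eq p).symm))
    subst hvv
    exact hI n hK
  · rcases kodairaSymbolAt_placeOf_cases_of_addv W p hp5 hadd with
      ⟨-, h⟩ | ⟨-, h⟩ | ⟨-, h⟩ | ⟨m, h, -⟩ | ⟨-, h⟩ | ⟨-, h⟩ | ⟨-, h⟩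
    · omega
    · omega
    · omega
    · exact absurd h (hI m)
    · exact Or.inl h
    · exact Or.inr (Or.inl h)
    · exact Or.inr (Or.inr h)

/-- **At `5`, a starred additive fibre without `Iₙ*` is (G)-ordinary iff it is of type III*
(`ord₅ Δ_min = 9`).** (⇒) types IV*/II* have `3 ∤ ord₅ Δ_min`, so `j̃ = 0`, supersingular at `5 ≡ 2 (3)`;
(⇐) `ord₅ Δ_min = 9` gives `12 ∣ 4·9` (Delbourgo (G), `typeG_iff_padicValRat`) and `j̃ = 1728`
(`2 ∤ 9`), ordinary at `5 ≡ 1 (4)`. The in-tree case `l = 5` of [DokchitserDokchitser2015, Thm. 3.2].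
[cite: DokchitserDokchitser2015LocalInvariants, Thm. 3.2] [cite: SilvermanAEC2009, V.4.1(a) and Exercises V.4.4–4.5] -/
theorem typeGOrd_iff_eq_nine_of_starred_five (h5 : p = 5) (hadd : Addv W p)
    (hI : ∀ n : ℕ, W.kodairaSymbolAt (placeOf p) ≠ .Istar n)
    (hv : 4 < padicValInt p W.minimalDiscriminantInt) :
    TypeGOrd W p ↔ padicValInt p W.minimalDiscriminantInt = 9 := by
  have hp5 : 5 ≤ p := by omega
  obtain ⟨hj, hmem⟩ := padicValRat_j_nonneg_and_mem_of_starred W p hp5 hadd hI hv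
  constructor
  · intro hG
    by_contra h9
    have h3 : ¬ 3 ∣ padicValInt p W.minimalDiscriminantInt := by
      intro h; rcases hmem with h' | h' | h' <;> omega
    exact not_typeGOrd_of_padicValRat_j_pos_of_not_three_dvd W p hp5 hadd (by subst h5; norm_num)
      (j_eq_zero_or_padicValRat_j_pos_of_not_three_dvd W p hj h3) hG
  · intro h9
    have h2 : ¬ 2 ∣ padicValInt p W.minimalDiscriminantInt := by omega
    have hG : TypeG W p := by
      refine (typeG_iff_padicValRat W p hp5).mpr ⟨hj, ?_⟩
      rw [padicValRat_Δ_eq W p, h9, h5]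
      norm_num
    exact typeGOrd_of_typeG_of_padicValRat_j_sub W p hp5 (by subst h5; norm_num) hG
      (j_eq_or_padicValRat_j_sub_pos_of_not_two_dvd W p hp5 hj h2)

/-- **At `7`, a starred additive fibre without `Iₙ*` is (G)-ordinary iff it is NOT of type III*
(`ord₇ Δ_min ≠ 9`, i.e. IV* or II*).** (⇒) type III* has `2 ∤ 9`, so `j̃ = 1728`, supersingular at
`7 ≡ 3 (4)`; (⇐) `ord₇ Δ_min ∈ {8, 10}` gives `12 ∣ 6·ord₇ Δ_min` (Delbourgo (G)) and `j̃ = 0` (`3 ∤ 8, 10`),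
ordinary at `7 ≡ 1 (3)`. The in-tree case `l = 7` of [DokchitserDokchitser2015, Thm. 3.2].
[cite: DokchitserDokchitser2015LocalInvariants, Thm. 3.2] [cite: SilvermanAEC2009, V.4.1(a) and Exercises V.4.4–4.5] -/
theorem typeGOrd_iff_ne_nine_of_starred_seven (h7 : p = 7) (hadd : Addv W p)
    (hI : ∀ n : ℕ, W.kodairaSymbolAt (placeOf p) ≠ .Istar n)
    (hv : 4 < padicValInt p W.minimalDiscriminantInt) :
    TypeGOrd W p ↔ padicValInt p W.minimalDiscriminantInt ≠ 9 := by
  have hp5 : 5 ≤ p := by omega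
  obtain ⟨hj, hmem⟩ := padicValRat_j_nonneg_and_mem_of_starred W p hp5 hadd hI hv
  constructor
  · intro hG h9
    have h2 : ¬ 2 ∣ padicValInt p W.minimalDiscriminantInt := by omega
    exact not_typeGOrd_of_padicValRat_j_sub_pos_of_not_four_dvd W p hp5 hadd (by subst h7; norm_num)
      ((j_eq_or_padicValRat_j_sub_pos_of_not_two_dvd W p hp5 hj h2).imp_left fun h ↦ sub_eq_zero.mpr h) hG
  · intro h9
    have h3 : ¬ 3 ∣ padicValInt p W.minimalDiscriminantInt := by
      intro h; rcases hmem with h' | h' | h' <;> omega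
    have hG : TypeG W p := by
      refine (typeG_iff_padicValRat W p hp5).mpr ⟨hj, ?_⟩
      rw [padicValRat_Δ_eq W p]
      rcases hmem with h' | h' | h'
      · rw [h', h7]; norm_num
      · exact absurd h' h9
      · rw [h', h7]; norm_num
    exact typeGOrd_of_typeG_of_padicValRat_j W p hp5 (by subst h7; norm_num) hG
      (j_eq_zero_or_padicValRat_j_pos_of_not_three_dvd W p hj h3)

end Dictionary

/-! ## §2 The two forms of the residual corner are equivalent -/

/-- **The non-(G)-ordinary corner (p621355's `hB'`) ⟸ its KODAIRA form** (binder `¬ TypeGOrd W p` replaced by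
`(p = 5 → ord_p Δ_min ≠ 9) → (p = 7 → ord_p Δ_min = 9)`, i.e. the cells (5; IV*/II*), (7; III*)), by §1.
[cite: DokchitserDokchitser2015LocalInvariants, Thm. 3.2] -/
theorem red57bistarredNonGord_of_kodairaCorner
    (hK : mazur_not_dvd_maninConstant_of_odd → abbesUllmo_not_dvd_maninConstant_of_not_dvd_level →
      cesnavicius_not_two_dvd_maninConstant_of_two_dvd_level → exists_isNewformOf →
      ∀ (W : WeierstrassCurve ℚ) [W.IsElliptic] [W.IsGloballyMinimal] [NeZero (W.conductorNorm ℤ)]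
        (D : ModularParametrizationData W (W.conductorNorm ℤ)),
        IsLatticeOptimal D → ∀ (p : ℕ) (hp : p.Prime), (p = 5 ∨ p = 7) → p ^ 2 ∣ W.conductorNorm ℤ →
        ¬ (∃ (W' : WeierstrassCurve ℚ) (q : ℕ), W'.IsElliptic ∧ W'.IsGloballyMinimal ∧ q.Prime ∧
            q ≠ 2 ∧ q ^ 2 ∣ W.conductorNorm ℤ ∧
            IsIsogenous W (W'.quadraticTwist (((-1 : ℤ) ^ (q / 2) * q : ℤ) : ℚ)) ∧
            ¬ q ^ 2 ∣ W'.conductorNorm ℤ) →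
        ¬ (∃ (W' : WeierstrassCurve ℚ) (d : ℤ), W'.IsElliptic ∧ W'.IsGloballyMinimal ∧
            (d = -1 ∨ d = 2 ∨ d = -2) ∧ 2 ^ 2 ∣ W.conductorNorm ℤ ∧
            IsIsogenous W (W'.quadraticTwist (d : ℚ)) ∧ ¬ 2 ^ 2 ∣ W'.conductorNorm ℤ) →
        ¬ W.HasIrreducibleModPGaloisRep p →
        500000 < W.conductorNorm ℤ →
        p ∣ D.modularDegree →
        (∀ n : ℕ, W.kodairaSymbolAt ((Rat.HeightOneSpectrum.primesEquiv (R := ℤ)).symm ⟨p, hp⟩) ≠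
          .Istar n) →
        4 < padicValInt p W.minimalDiscriminantInt →
        (p = 5 → padicValInt p W.minimalDiscriminantInt ≠ 9) →
        (p = 7 → padicValInt p W.minimalDiscriminantInt = 9) →
        (∀ (W₀ : WeierstrassCurve ℚ) [W₀.IsElliptic] [W₀.IsGloballyMinimal] [NeZero (W₀.conductorNorm ℤ)]
            (D₀ : ModularParametrizationData W₀ (W₀.conductorNorm ℤ)), IsLatticeOptimal D₀ →
            IsIsogenous (W.quadraticTwist ((((-1 : ℤ) ^ (p / 2) * p : ℤ)) : ℚ)) W₀ →
            4 < padicValInt p W₀.minimalDiscriminantInt) →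
        ¬ (p : ℤ) ∣ D.maninConstant) :
    mazur_not_dvd_maninConstant_of_odd → abbesUllmo_not_dvd_maninConstant_of_not_dvd_level →
    cesnavicius_not_two_dvd_maninConstant_of_two_dvd_level → exists_isNewformOf →
    ∀ (W : WeierstrassCurve ℚ) [W.IsElliptic] [W.IsGloballyMinimal] [NeZero (W.conductorNorm ℤ)]
      (D : ModularParametrizationData W (W.conductorNorm ℤ)),
      IsLatticeOptimal D → ∀ (p : ℕ) (hp : p.Prime), (p = 5 ∨ p = 7) → p ^ 2 ∣ W.conductorNorm ℤ →
      ¬ (∃ (W' : WeierstrassCurve ℚ) (q : ℕ), W'.IsElliptic ∧ W'.IsGloballyMinimal ∧ q.Prime ∧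
          q ≠ 2 ∧ q ^ 2 ∣ W.conductorNorm ℤ ∧
          IsIsogenous W (W'.quadraticTwist (((-1 : ℤ) ^ (q / 2) * q : ℤ) : ℚ)) ∧
          ¬ q ^ 2 ∣ W'.conductorNorm ℤ) →
      ¬ (∃ (W' : WeierstrassCurve ℚ) (d : ℤ), W'.IsElliptic ∧ W'.IsGloballyMinimal ∧
          (d = -1 ∨ d = 2 ∨ d = -2) ∧ 2 ^ 2 ∣ W.conductorNorm ℤ ∧
          IsIsogenous W (W'.quadraticTwist (d : ℚ)) ∧ ¬ 2 ^ 2 ∣ W'.conductorNorm ℤ) →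
      ¬ W.HasIrreducibleModPGaloisRep p →
      500000 < W.conductorNorm ℤ →
      p ∣ D.modularDegree →
      (∀ n : ℕ, W.kodairaSymbolAt ((Rat.HeightOneSpectrum.primesEquiv (R := ℤ)).symm ⟨p, hp⟩) ≠
        .Istar n) →
      4 < padicValInt p W.minimalDiscriminantInt →
      ¬ TypeGOrd W p →
      (∀ (W₀ : WeierstrassCurve ℚ) [W₀.IsElliptic] [W₀.IsGloballyMinimal] [NeZero (W₀.conductorNorm ℤ)]
          (D₀ : ModularParametrizationData W₀ (W₀.conductorNorm ℤ)), IsLatticeOptimal D₀ →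
          IsIsogenous (W.quadraticTwist ((((-1 : ℤ) ^ (p / 2) * p : ℤ)) : ℚ)) W₀ →
          4 < padicValInt p W₀.minimalDiscriminantInt) →
      ¬ (p : ℤ) ∣ D.maninConstant := by
  intro hM hAU hC hnf W _ _ _ D hD p hp h57 hpN hodd hdy hred hN hdeg hI hv hG hall
  haveI : Fact p.Prime := ⟨hp⟩
  have hadd : Addv W p := not_good_and_not_mult_of_sq_dvd_conductorNorm W hpN
  have hI' : ∀ n : ℕ, W.kodairaSymbolAt (placeOf p) ≠ .Istar n := hI
  refine hK hM hAU hC hnf W D hD p hp h57 hpN hodd hdy hred hN hdeg hI hv ?_ ?_ hall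
  · intro h5 h9
    exact hG ((typeGOrd_iff_eq_nine_of_starred_five W p h5 hadd hI' hv).mpr h9)
  · intro h7
    by_contra h9
    exact hG ((typeGOrd_iff_ne_nine_of_starred_seven W p h7 hadd hI' hv).mpr h9)

/-- **Conversely, the KODAIRA-form corner ⟸ the non-(G)-ordinary corner**: on the cells (5; IV*/II*),
(7; III*) the curve is not (G)-ordinary (§1), so the two residual forms are EQUIVALENT.
[cite: DokchitserDokchitser2015LocalInvariants, Thm. 3.2] -/
theorem red57bistarredKodairaCorner_of_nonGord
    (hB' : mazur_not_dvd_maninConstant_of_odd → abbesUllmo_not_dvd_maninConstant_of_not_dvd_level →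
      cesnavicius_not_two_dvd_maninConstant_of_two_dvd_level → exists_isNewformOf →
      ∀ (W : WeierstrassCurve ℚ) [W.IsElliptic] [W.IsGloballyMinimal] [NeZero (W.conductorNorm ℤ)]
        (D : ModularParametrizationData W (W.conductorNorm ℤ)),
        IsLatticeOptimal D → ∀ (p : ℕ) (hp : p.Prime), (p = 5 ∨ p = 7) → p ^ 2 ∣ W.conductorNorm ℤ →
        ¬ (∃ (W' : WeierstrassCurve ℚ) (q : ℕ), W'.IsElliptic ∧ W'.IsGloballyMinimal ∧ q.Prime ∧
            q ≠ 2 ∧ q ^ 2 ∣ W.conductorNorm ℤ ∧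
            IsIsogenous W (W'.quadraticTwist (((-1 : ℤ) ^ (q / 2) * q : ℤ) : ℚ)) ∧
            ¬ q ^ 2 ∣ W'.conductorNorm ℤ) →
        ¬ (∃ (W' : WeierstrassCurve ℚ) (d : ℤ), W'.IsElliptic ∧ W'.IsGloballyMinimal ∧
            (d = -1 ∨ d = 2 ∨ d = -2) ∧ 2 ^ 2 ∣ W.conductorNorm ℤ ∧
            IsIsogenous W (W'.quadraticTwist (d : ℚ)) ∧ ¬ 2 ^ 2 ∣ W'.conductorNorm ℤ) →
        ¬ W.HasIrreducibleModPGaloisRep p →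
        500000 < W.conductorNorm ℤ →
        p ∣ D.modularDegree →
        (∀ n : ℕ, W.kodairaSymbolAt ((Rat.HeightOneSpectrum.primesEquiv (R := ℤ)).symm ⟨p, hp⟩) ≠
          .Istar n) →
        4 < padicValInt p W.minimalDiscriminantInt →
        ¬ TypeGOrd W p →
        (∀ (W₀ : WeierstrassCurve ℚ) [W₀.IsElliptic] [W₀.IsGloballyMinimal] [NeZero (W₀.conductorNorm ℤ)]
            (D₀ : ModularParametrizationData W₀ (W₀.conductorNorm ℤ)), IsLatticeOptimal D₀ →
            IsIsogenous (W.quadraticTwist ((((-1 : ℤ) ^ (p / 2) * p : ℤ)) : ℚ)) W₀ →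
            4 < padicValInt p W₀.minimalDiscriminantInt) →
        ¬ (p : ℤ) ∣ D.maninConstant) :
    mazur_not_dvd_maninConstant_of_odd → abbesUllmo_not_dvd_maninConstant_of_not_dvd_level →
    cesnavicius_not_two_dvd_maninConstant_of_two_dvd_level → exists_isNewformOf →
    ∀ (W : WeierstrassCurve ℚ) [W.IsElliptic] [W.IsGloballyMinimal] [NeZero (W.conductorNorm ℤ)]
      (D : ModularParametrizationData W (W.conductorNorm ℤ)),
      IsLatticeOptimal D → ∀ (p : ℕ) (hp : p.Prime), (p = 5 ∨ p = 7) → p ^ 2 ∣ W.conductorNorm ℤ →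
      ¬ (∃ (W' : WeierstrassCurve ℚ) (q : ℕ), W'.IsElliptic ∧ W'.IsGloballyMinimal ∧ q.Prime ∧
          q ≠ 2 ∧ q ^ 2 ∣ W.conductorNorm ℤ ∧
          IsIsogenous W (W'.quadraticTwist (((-1 : ℤ) ^ (q / 2) * q : ℤ) : ℚ)) ∧
          ¬ q ^ 2 ∣ W'.conductorNorm ℤ) →
      ¬ (∃ (W' : WeierstrassCurve ℚ) (d : ℤ), W'.IsElliptic ∧ W'.IsGloballyMinimal ∧
          (d = -1 ∨ d = 2 ∨ d = -2) ∧ 2 ^ 2 ∣ W.conductorNorm ℤ ∧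
          IsIsogenous W (W'.quadraticTwist (d : ℚ)) ∧ ¬ 2 ^ 2 ∣ W'.conductorNorm ℤ) →
      ¬ W.HasIrreducibleModPGaloisRep p →
      500000 < W.conductorNorm ℤ →
      p ∣ D.modularDegree →
      (∀ n : ℕ, W.kodairaSymbolAt ((Rat.HeightOneSpectrum.primesEquiv (R := ℤ)).symm ⟨p, hp⟩) ≠
        .Istar n) →
      4 < padicValInt p W.minimalDiscriminantInt →
      (p = 5 → padicValInt p W.minimalDiscriminantInt ≠ 9) →
      (p = 7 → padicValInt p W.minimalDiscriminantInt = 9) →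
      (∀ (W₀ : WeierstrassCurve ℚ) [W₀.IsElliptic] [W₀.IsGloballyMinimal] [NeZero (W₀.conductorNorm ℤ)]
          (D₀ : ModularParametrizationData W₀ (W₀.conductorNorm ℤ)), IsLatticeOptimal D₀ →
          IsIsogenous (W.quadraticTwist ((((-1 : ℤ) ^ (p / 2) * p : ℤ)) : ℚ)) W₀ →
          4 < padicValInt p W₀.minimalDiscriminantInt) →
      ¬ (p : ℤ) ∣ D.maninConstant := by
  intro hM hAU hC hnf W _ _ _ D hD p hp h57 hpN hodd hdy hred hN hdeg hI hv h5 h7 hall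
  haveI : Fact p.Prime := ⟨hp⟩
  have hadd : Addv W p := not_good_and_not_mult_of_sq_dvd_conductorNorm W hpN
  have hI' : ∀ n : ℕ, W.kodairaSymbolAt (placeOf p) ≠ .Istar n := hI
  refine hB' hM hAU hC hnf W D hD p hp h57 hpN hodd hdy hred hN hdeg hI hv ?_ hall
  rcases h57 with hp5 | hp7
  · exact fun hG ↦ h5 hp5 ((typeGOrd_iff_eq_nine_of_starred_five W p hp5 hadd hI' hv).mp hG)
  · exact fun hG ↦ (typeGOrd_iff_ne_nine_of_starred_seven W p hp7 hadd hI' hv).mp hG (h7 hp7)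

/-! ## §3 Composition with λ (p621355) -/

/-- **`stub_red57bistarred` ⟸ Dokchitser–Dokchitser 2015 Thm. 5.1 (1) ∧ the KODAIRA-form corner** ((5; IV*/II*),
(7; III*): starred optimal `W[p]`-reducible twist-minimal curves, `p² ∣ N > 5·10⁵`, `p ∣ deg φ`, all of whose
lattice-optimal `χ_{p*}`-partners are starred). p621355 §1 ∘ §2. Conditional result; closes nothing.
[cite: DokchitserDokchitser2015LocalInvariants, Thm. 5.1 (1), Thm. 3.2] -/
theorem red57bistarred_of_dokchitser_of_kodairaCorner
    (hDD : dokchitser_padicValInt_minimalDiscriminantInt_eq_of_isogeny_of_potentiallyGoodOrdinary)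
    (hK : mazur_not_dvd_maninConstant_of_odd → abbesUllmo_not_dvd_maninConstant_of_not_dvd_level →
      cesnavicius_not_two_dvd_maninConstant_of_two_dvd_level → exists_isNewformOf →
      ∀ (W : WeierstrassCurve ℚ) [W.IsElliptic] [W.IsGloballyMinimal] [NeZero (W.conductorNorm ℤ)]
        (D : ModularParametrizationData W (W.conductorNorm ℤ)),
        IsLatticeOptimal D → ∀ (p : ℕ) (hp : p.Prime), (p = 5 ∨ p = 7) → p ^ 2 ∣ W.conductorNorm ℤ →
        ¬ (∃ (W' : WeierstrassCurve ℚ) (q : ℕ), W'.IsElliptic ∧ W'.IsGloballyMinimal ∧ q.Prime ∧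
            q ≠ 2 ∧ q ^ 2 ∣ W.conductorNorm ℤ ∧
            IsIsogenous W (W'.quadraticTwist (((-1 : ℤ) ^ (q / 2) * q : ℤ) : ℚ)) ∧
            ¬ q ^ 2 ∣ W'.conductorNorm ℤ) →
        ¬ (∃ (W' : WeierstrassCurve ℚ) (d : ℤ), W'.IsElliptic ∧ W'.IsGloballyMinimal ∧
            (d = -1 ∨ d = 2 ∨ d = -2) ∧ 2 ^ 2 ∣ W.conductorNorm ℤ ∧
            IsIsogenous W (W'.quadraticTwist (d : ℚ)) ∧ ¬ 2 ^ 2 ∣ W'.conductorNorm ℤ) →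
        ¬ W.HasIrreducibleModPGaloisRep p →
        500000 < W.conductorNorm ℤ →
        p ∣ D.modularDegree →
        (∀ n : ℕ, W.kodairaSymbolAt ((Rat.HeightOneSpectrum.primesEquiv (R := ℤ)).symm ⟨p, hp⟩) ≠
          .Istar n) →
        4 < padicValInt p W.minimalDiscriminantInt →
        (p = 5 → padicValInt p W.minimalDiscriminantInt ≠ 9) →
        (p = 7 → padicValInt p W.minimalDiscriminantInt = 9) →
        (∀ (W₀ : WeierstrassCurve ℚ) [W₀.IsElliptic] [W₀.IsGloballyMinimal] [NeZero (W₀.conductorNorm ℤ)]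
            (D₀ : ModularParametrizationData W₀ (W₀.conductorNorm ℤ)), IsLatticeOptimal D₀ →
            IsIsogenous (W.quadraticTwist ((((-1 : ℤ) ^ (p / 2) * p : ℤ)) : ℚ)) W₀ →
            4 < padicValInt p W₀.minimalDiscriminantInt) →
        ¬ (p : ℤ) ∣ D.maninConstant) :
    mazur_not_dvd_maninConstant_of_odd → abbesUllmo_not_dvd_maninConstant_of_not_dvd_level →
    cesnavicius_not_two_dvd_maninConstant_of_two_dvd_level → exists_isNewformOf →
    ∀ (W : WeierstrassCurve ℚ) [W.IsElliptic] [W.IsGloballyMinimal] [NeZero (W.conductorNorm ℤ)]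
      (D : ModularParametrizationData W (W.conductorNorm ℤ)),
      IsLatticeOptimal D → ∀ (p : ℕ) (hp : p.Prime), (p = 5 ∨ p = 7) → p ^ 2 ∣ W.conductorNorm ℤ →
      ¬ (∃ (W' : WeierstrassCurve ℚ) (q : ℕ), W'.IsElliptic ∧ W'.IsGloballyMinimal ∧ q.Prime ∧
          q ≠ 2 ∧ q ^ 2 ∣ W.conductorNorm ℤ ∧
          IsIsogenous W (W'.quadraticTwist (((-1 : ℤ) ^ (q / 2) * q : ℤ) : ℚ)) ∧
          ¬ q ^ 2 ∣ W'.conductorNorm ℤ) →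
      ¬ (∃ (W' : WeierstrassCurve ℚ) (d : ℤ), W'.IsElliptic ∧ W'.IsGloballyMinimal ∧
          (d = -1 ∨ d = 2 ∨ d = -2) ∧ 2 ^ 2 ∣ W.conductorNorm ℤ ∧
          IsIsogenous W (W'.quadraticTwist (d : ℚ)) ∧ ¬ 2 ^ 2 ∣ W'.conductorNorm ℤ) →
      ¬ W.HasIrreducibleModPGaloisRep p →
      500000 < W.conductorNorm ℤ →
      p ∣ D.modularDegree →
      (∀ n : ℕ, W.kodairaSymbolAt ((Rat.HeightOneSpectrum.primesEquiv (R := ℤ)).symm ⟨p, hp⟩) ≠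
        .Istar n) →
      4 < padicValInt p W.minimalDiscriminantInt →
      (∀ (W₀ : WeierstrassCurve ℚ) [W₀.IsElliptic] [W₀.IsGloballyMinimal] [NeZero (W₀.conductorNorm ℤ)]
          (D₀ : ModularParametrizationData W₀ (W₀.conductorNorm ℤ)), IsLatticeOptimal D₀ →
          IsIsogenous (W.quadraticTwist ((((-1 : ℤ) ^ (p / 2) * p : ℤ)) : ℚ)) W₀ →
          4 < padicValInt p W₀.minimalDiscriminantInt) →
      ¬ (p : ℤ) ∣ D.maninConstant :=
  red57bistarred_of_dokchitser_of_nonGordCorner hDD (red57bistarredNonGord_of_kodairaCorner hK)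

end Summit.BirchSwinnertonDyer.BirchSwinnertonDyer.Theorems

end
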